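import Literature.Probability.RandomPlanarGeometry.HexSAWPolygonStepTwoTwoCorner
import HarnessLib

/-!
# The step `2` for honeycomb polygon numbers, THIRD SLOT (II): the LEAF CROWN at a top-right leaf next to a gap of the top row
# `#{X ∪ Y⋆ ∪ (leaf ∩ bottom-served) ∪ (leaf-crown ∩ bottom-leaf)} ≤ q_{N+2}(ℍ)`

Topic `Literature/Probability/RandomPlanarGeometry` (lane «pcv-sawmu», a-p4 g20; companion of `HexSAWPolygonStepTwoLeafSlide.lean` and
sequel of `HexSAWPolygonStepTwoTwoCorner.lean` — `card_filter_isStepTwoTwoCorner_le`, `IsStepTwoTwoCorner`, `IsStepTwoBottom`,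
`BottomDatum`, `exists_stepTwoBottom_image`, `eq_of_stepTwoBottom_image_eq`, `isTopLeaf_of_bottomDatum`, `not_isTopLeaf_of_roofDatum`,
`stepTwo_classify_bottom`, `BotSix`, `botAt_unique`, `botAt_spliceXb`, `botAt_spliceYsb`, `spliceXb_signature_fwd/bwd`,
`spliceYsb_sites_fwd/bwd` —, of `HexSAWPolygonStepTwoYStar.lean` — `IsTopLeaf`, `RoofDatum`, `exists_stepTwoRoof_image`,
`eq_of_stepTwoRoof_image_eq`, `topSix_of_isTopLeaf`, `notX_pred_fwd`, `notX_succ_bwd`, `corner_pred_of_succ_down`,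
`corner_succ_of_pred_down` — and of `HexSAWPolygonStepTwoMain.lean` / `HexSAWPolygonStepSix.lean` — `spliceAdd`, `SpliceAddOK`,
`spliceAddOK_of_tables`, `eq_of_spliceAdd_eq`, `topAt_spliceAdd`, `spliceAdd_site_cases`, `tpath`, `tpath_mem`, `rd`, `TopSix`,
`topAt_unique`, `top_corner_pred`, `top_corner_succ`).

Write the top corner as `(xm, H) = ω i₀`; the top-right hexagon `c = [xm−2,xm]×[H−1,H]` is an up-right LEAF hanging on
`d = [xm−3,xm−1]×[H−2,H−1]`.  When the support run is long (`ω (i₀∓5) = (xm−4,H−1)`) and the hexagon `[xm−6,xm−4]×[H−1,H]` two places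
left of `c` IS in the polygon (`ω (i₀∓6) = (xm−4, H)`: the top row has a ONE-HEXAGON GAP left of `c`), the leaf slide of the companion
file does not apply; the **leaf crown** FILLS the gap (the hexagon `[xm−4,xm−2]×[H−1,H]` has four contacts: `−2`) and puts the hexagon
`[xm−1,xm+1]×[H,H+1]` on top of `c` (`+4`): net `+2`.  On the boundary walk this is ONE fixed window of `7` bonds,
`(xm−4,H)(xm−4,H−1)(xm−3,H−1)(xm−2,H−1)(xm−2,H)(xm−1,H)(xm,H)(xm,H−1)`, replaced by the `9`-bond path
`(xm−4,H)(xm−3,H)(xm−2,H)(xm−1,H)(xm−1,H+1)(xm,H+1)(xm+1,H+1)(xm+1,H)(xm,H)(xm,H−1)` (tables `wV`, `offV`; `spliceAdd 2 7`), admissible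
with no further side condition and root-safe (`xm ≥ 4` is forced).  The image's top corner is `(xm+1, H+1)` and its top-right hexagon
is again an up-right LEAF — so the image is never a top image of the two-corner map —, and the surgery changes sites of height `≥ H` only,
so a polygon whose BOTTOM-right hexagon is a down-right leaf keeps that property: the image is never a bottom image either (a bottom
image's bottom-right hexagon has two upper contacts, `not_isBotLeaf_of_bottomDatum`).  The crown is therefore applied to the
leaf-crown polygons of the BOTTOM-LEAF class `IsBotLeaf` (the mirror image of `IsTopLeaf`; the two-corner residue is numerically
exactly top-leaf ∧ bottom-leaf for `N ≥ 14`).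

PART I: tables, `spliceOK_V`, the forced window `stepTwo_data_V_fwd/bwd`, the image corner `topAt_spliceV`, `isTopLeaf_spliceV`,
`spliceV_decode`.  PART II: `IsBotLeaf`, `isBotLeaf_spliceAdd_high` (a bottom leaf survives every `+2` splice at heights `≥ L+2`),
`not_isBotLeaf_of_bottomDatum`.  PART III: the class `IsLeafCrown`, `CrownDatum`, `exists_leafCrown_image`,
`eq_of_leafCrown_image_eq`, and the injection ★ **`card_filter_isStepTwoCrownSlot_le : 5 ≤ n →
#{ω ∈ canonEnd n | IsStepTwoTwoCorner n ω ∨ (IsLeafCrown n ω ∧ IsBotLeaf n ω)} ≤ #canonEnd (n+2)`**, complement and printed forms.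

NOT claimed: `q_N(ℍ) ≤ q_{N+2}(ℍ)`.  Numerically (`HOME/pub-sawmu-a-p4/g20/three/py/slideUV.py`) the crown serves `0,0,0,0,1,2,11,21,87`
of the two-corner residue for `N = 14, …, 30`; together with the leaf slide the residue becomes the «domino antenna» tops (support run of
length one): `1, 0, 2, 1, 7, 11, 41, 93, 306` of `12, …, 25 999` (≈ 1.2 %).  The joint four-slot assembly (slide and crown images are
distinct: a slide image is not top-leaf, a crown image is) is left to the sequel importing both files.
Label (lane): LANE LEMMA / infrastructure for an open combinatorial item; no literature claim beyond the transplanted `ℤ^d` method.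
-/

noncomputable section

open Finset Function Literature.Probability.LatticeModels Literature.Probability.Percolation SimpleGraph

namespace Literature.Probability.RandomPlanarGeometry.SAW

namespace HexBW

namespace PolygonConcat

variable {n : ℕ} {ω : ℕ → Site 2}

/-- Two sites of `ℤ²` are equal iff both coordinates agree. [folklore; lane plumbing] [cite: MadrasSlade1993, §1.1] -/
private theorem lc_site_eq_iff {x y : Site 2} : x = y ↔ x 0 = y 0 ∧ x 1 = y 1 := by
  constructor
  · rintro rfl; exact ⟨rfl, rfl⟩
  · rintro ⟨h0, h1⟩; funext i; fin_cases i <;> assumption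

/-- `pt a b` is lexicographically `≥ 0` when `a > 0`, or `a = 0 ≤ b`. [cite: MadrasSlade1993, §3.2 (proof of Theorem 3.2.3: `Q[N]`)] -/
private theorem lc_lexNonneg_pt {a b : ℤ} (h : 0 < a ∨ (a = 0 ∧ 0 ≤ b)) : LexNonneg (pt a b) := by
  unfold LexNonneg; simpa using h

/-! ### PART I — the leaf crown as a fixed-window surgery -/

section CrownTables

variable {xm H : ℤ} {fwd : Bool} {j : ℕ}

/-- Window table of the leaf crown (offsets from the top corner `(xm,H)`): `(xm−4,H)(xm−4,H−1)(xm−3,H−1)(xm−2,H−1)(xm−2,H)(xm−1,H)(xm,H)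
(xm,H−1)` — down the right side of the hexagon left of the gap, along the top of the support run, around the top-right leaf hexagon.
[cite: MadrasSlade1993, §3.2 (proof of Theorem 3.2.3: local surgery at the lexicographically largest point)] -/
def wV : ℕ → ℤ × ℤ
  | 0 => (-4, 0) | 1 => (-4, -1) | 2 => (-3, -1) | 3 => (-2, -1) | 4 => (-2, 0) | 5 => (-1, 0) | 6 => (0, 0) | _ => (0, -1)

/-- New-path table of the leaf crown: `(xm−4,H)(xm−3,H)(xm−2,H)(xm−1,H)(xm−1,H+1)(xm,H+1)(xm+1,H+1)(xm+1,H)(xm,H)(xm,H−1)` — straight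
along the filled top row, then around the crown hexagon `[xm−1,xm+1]×[H,H+1]`. [cite: MadrasSlade1993, §3.2 (proof of Theorem 3.2.3: local surgery)] -/
def offV : ℕ → ℤ × ℤ
  | 0 => (-4, 0) | 1 => (-3, 0) | 2 => (-2, 0) | 3 => (-1, 0) | 4 => (-1, 1) | 5 => (0, 1) | 6 => (1, 1) | 7 => (1, 0) | 8 => (0, 0)
  | _ => (0, -1)

/-- Table V is a brick-wall path (given the top-corner parity `xm + H` odd). [cite: EntingJensen2009, §7.4.2, Fig. 7.10] -/
theorem offV_adj (hpar : (xm + H) % 2 = 1) {s : ℕ} (hs : s < 9) :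
    brickWallGraph.Adj (pt (xm + (offV s).1) (H + (offV s).2)) (pt (xm + (offV (s + 1)).1) (H + (offV (s + 1)).2)) := by
  interval_cases s <;> simp only [offV] <;> exact adj_pt_iff.2 (by omega)

/-- Table V is injective on `[0,9]`. [cite: MadrasSlade1993, §3.2] -/
theorem offV_inj {s s' : ℕ} (hs : s ≤ 9) (hs' : s' ≤ 9)
    (h : pt (xm + (offV s).1) (H + (offV s).2) = pt (xm + (offV s').1) (H + (offV s').2)) : s = s' := by
  interval_cases s <;> interval_cases s' <;> simp only [offV] at h <;>
    first | rfl | (obtain ⟨h1, h2⟩ := pt_inj.1 h; omega)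

/-- **The leaf crown is admissible**: for `xm ≥ 4`, `H ≥ 1`, `(xm−3,H)` off `ω` and the window `wV` read on `ω` from time `j`, the new
path satisfies `SpliceAddOK n 2 7`.  Freshness: the three crown sites have height `H+1`; `(xm+1,H)` lies right of the top corner;
`(xm−3,H)` is off `ω` by hypothesis; `(xm−2,H)`, `(xm−1,H)`, `(xm,H)` are window sites of `ω`.
[cite: MadrasSlade1993, §3.2 (proof of Theorem 3.2.3: local surgery)] -/
theorem spliceOK_V (hω : ω ∈ endAt n (Pi.single 0 1 : Site 2)) (hpar : (xm + H) % 2 = 1) (hx : 4 ≤ xm) (hH : 1 ≤ H)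
    (hmaxH : ∀ i, i ≤ n → ω i 1 ≤ H) (hmaxX : ∀ i, i ≤ n → ω i 1 = H → ω i 0 ≤ xm)
    (hX3 : ∀ t, t ≤ n → ω t ≠ pt (xm - 3) H)
    (hw : ∀ s, s ≤ 7 → ω (j + s) = tpath wV 7 xm H fwd s) (hwnd : j + 7 ≤ n) :
    SpliceAddOK n 2 7 ω j (tpath offV 9 xm H fwd) := by
  have hinj := (mem_endAt_iff.1 hω).1.2.2.2
  have hwin : ∀ u, u ≤ 7 → ∀ i, i ≤ n → (i < j ∨ j + 7 < i) → pt (xm + (wV u).1) (H + (wV u).2) ≠ ω i := by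
    intro u hu i hi hio he
    have hs : ∃ s, s ≤ 7 ∧ rd fwd 7 s = u := by
      cases fwd
      · exact ⟨7 - u, by omega, by unfold rd; simp; omega⟩
      · exact ⟨u, hu, by unfold rd; simp⟩
    obtain ⟨s, hs7, hsu⟩ := hs
    have e : ω (j + s) = pt (xm + (wV u).1) (H + (wV u).2) := by rw [hw s hs7, tpath, hsu]
    have := hinj (show j + s ∈ {i | i ≤ n} by simp; omega) (show i ∈ {i | i ≤ n} by simpa using hi) (by rw [e, he])
    omega
  refine spliceAddOK_of_tables (L := 7) (K := 2) (w := wV) (by norm_num) (by rfl) (by rfl) (fun s hs => offV_adj hpar hs)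
    (fun s s' hs hs' h => offV_inj hs hs' h) (fun u hu0 hu1 i hi hio => ?_) (fun u hu => ?_) hw hwnd
  · interval_cases u <;> simp only [offV]
    · exact fun h => hX3 i hi (h.symm.trans (pt_inj.2 ⟨by ring, by ring⟩))
    · exact hwin 4 (by norm_num) i hi hio
    · exact hwin 5 (by norm_num) i hi hio
    · exact ne_of_high hmaxH hmaxX (by omega) hi
    · exact ne_of_high hmaxH hmaxX (by omega) hi
    · exact ne_of_high hmaxH hmaxX (by omega) hi
    · exact ne_of_high hmaxH hmaxX (by omega) hi
    · exact hwin 6 (by norm_num) i hi hio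
  · interval_cases u <;> simp only [offV] <;> exact lc_lexNonneg_pt (by omega)

end CrownTables


/-! ### The forced window around a top-right leaf next to a gap of the top row -/

section CrownData

variable {xm H : ℤ}

/-- **Leaf-crown datum, forward.**  At a top corner `ω i₀ = (xm,H)` of the LEAF class (`(xm−3,H)` off `ω`, `ω (i₀+1) = (xm,H−1)`,
`ω (i₀+2) = (xm−1,H−1)`) with `ω (i₀−5) = (xm−4,H−1)` and `ω (i₀−6) = (xm−4,H)`, the `7`-window from time `i₀ − 6` is forced —
`(xm−4,H)(xm−4,H−1)(xm−3,H−1)(xm−2,H−1)(xm−2,H)(xm−1,H)(xm,H)(xm,H−1)` —, `xm ≥ 4`, and the crown is admissible there.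
[cite: MadrasSlade1993, §3.2 (proof of Theorem 3.2.3: the local structure at the lexicographically largest point)] -/
theorem stepTwo_data_V_fwd (hω : ω ∈ canonEnd n) {i₀ : ℕ} (hi₀n : i₀ + 2 ≤ n) (hv : ω i₀ = pt xm H) (hx2 : 2 ≤ xm)
    (hmaxH : ∀ i, i ≤ n → ω i 1 ≤ H) (hmaxX : ∀ i, i ≤ n → ω i 1 = H → ω i 0 ≤ xm)
    (hX3 : ∀ t, t ≤ n → ω t ≠ pt (xm - 3) H)
    (hs1 : ω (i₀ + 1) = pt xm (H - 1)) (hs2 : ω (i₀ + 2) = pt (xm - 1) (H - 1))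
    (hi₀6 : 6 ≤ i₀) (hp5 : ω (i₀ - 5) = pt (xm - 4) (H - 1)) (hp6 : ω (i₀ - 6) = pt (xm - 4) H) :
    4 ≤ xm ∧ SpliceAddOK n 2 7 ω (i₀ - 6) (tpath offV 9 xm H true) ∧
      (∀ s, s ≤ 7 → ω (i₀ - 6 + s) = tpath wV 7 xm H true s) := by
  obtain ⟨hE, hlex⟩ := mem_canonEnd.1 hω
  obtain ⟨⟨h0, -, hbw, hinj⟩, hn'⟩ := mem_endAt_iff.1 hE
  have hH1 : 1 ≤ H := by
    have h1 := apply_one_of_mem_canonEnd hω (by omega); have := hmaxH 1 (by omega); rw [h1.2] at this; exact this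
  have hpar : (xm + H) % 2 = 1 := by
    have hvc := vertical_cases (hbw i₀ (by omega)) (by rw [hv, hs1]; simp)
    rw [hv, hs1] at hvc; simp only [pt_apply_zero, pt_apply_one] at hvc; omega
  obtain ⟨hi₀1, p1⟩ := corner_pred_of_succ_down hE hx2 hmaxH hmaxX (by omega) hv hs1
  obtain ⟨hi₀2, p2⟩ := top_corner_pred hω hi₀1 (by omega) hv hmaxH p1 hs1
  obtain ⟨hi₀3, p3⟩ := notX_pred_fwd hE hpar hH1 hmaxH hi₀2 (by omega) p2 p1 hX3
  have p4 : ω (i₀ - 4) = pt (xm - 3) (H - 1) := by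
    have hadj : brickWallGraph.Adj (ω (i₀ - 3)) (ω (i₀ - 4)) := by
      have := hbw (i₀ - 4) (by omega); rw [show i₀ - 4 + 1 = i₀ - 3 by omega] at this; exact this.symm
    rw [p3] at hadj
    have hne2 : ω (i₀ - 4) ≠ ω (i₀ + 2) := fun h => by
      have := hinj (show i₀ - 4 ∈ {i | i ≤ n} by simp; omega) (show i₀ + 2 ∈ {i | i ≤ n} by simp; omega) h; omega
    have hne3 : ω (i₀ - 4) ≠ ω (i₀ - 2) := fun h => by
      have := hinj (show i₀ - 4 ∈ {i | i ≤ n} by simp; omega) (show i₀ - 2 ∈ {i | i ≤ n} by simp; omega) h; omega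
    rcases adj_cases hadj with ⟨hz0, hz1⟩ | ⟨hz0, hz1⟩ | hz0
    · exfalso; apply hne2; rw [hs2, lc_site_eq_iff]; simp only [pt_apply_zero, pt_apply_one] at hz0 hz1 ⊢; omega
    · rw [lc_site_eq_iff]; simp only [pt_apply_zero, pt_apply_one] at hz0 hz1 ⊢; omega
    · rcases vertical_cases hadj hz0 with ⟨hy, hp⟩ | ⟨hy, hp⟩
      · exfalso; apply hne3; rw [p2, lc_site_eq_iff]; simp only [pt_apply_zero, pt_apply_one] at hz0 hy ⊢; omega
      · exfalso; simp only [pt_apply_zero, pt_apply_one] at hz0 hy hp; omega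
  have hx4 : 4 ≤ xm := by have := col_nonneg_of_mem_canonEnd hω (i₀ - 6); rw [hp6] at this; simp at this; omega
  have hw : ∀ s, s ≤ 7 → ω (i₀ - 6 + s) = tpath wV 7 xm H true s := by
    intro s hs
    interval_cases s
    · exact tpath_eq (by rw [show i₀ - 6 + 0 = i₀ - 6 by omega, hp6]) (by simp [rd, wV])
    · exact tpath_eq (by rw [show i₀ - 6 + 1 = i₀ - 5 by omega, hp5]) (by simp [rd, wV])
    · exact tpath_eq (by rw [show i₀ - 6 + 2 = i₀ - 4 by omega, p4]) (by simp [rd, wV])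
    · exact tpath_eq (by rw [show i₀ - 6 + 3 = i₀ - 3 by omega, p3]) (by simp [rd, wV])
    · exact tpath_eq (by rw [show i₀ - 6 + 4 = i₀ - 2 by omega, p2]) (by simp [rd, wV])
    · exact tpath_eq (by rw [show i₀ - 6 + 5 = i₀ - 1 by omega, p1]) (by simp [rd, wV])
    · exact tpath_eq (by rw [show i₀ - 6 + 6 = i₀ by omega, hv]) (by simp [rd, wV])
    · exact tpath_eq (by rw [show i₀ - 6 + 7 = i₀ + 1 by omega, hs1]) (by simp [rd, wV])
  exact ⟨hx4, spliceOK_V hE hpar hx4 hH1 hmaxH hmaxX hX3 hw (by omega), hw⟩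

/-- **Leaf-crown datum, backward** (`ω (i₀−1) = (xm,H−1)`, `ω (i₀−2) = (xm−1,H−1)`, `ω (i₀+5) = (xm−4,H−1)`, `ω (i₀+6) = (xm−4,H)`):
the `7`-window sits at `i₀ − 1` and is read backwards. [cite: MadrasSlade1993, §3.2 (proof of Theorem 3.2.3)] -/
theorem stepTwo_data_V_bwd (hω : ω ∈ canonEnd n) {i₀ : ℕ} (hi₀2 : 2 ≤ i₀) (hi₀6n : i₀ + 6 ≤ n) (hv : ω i₀ = pt xm H) (hx2 : 2 ≤ xm)
    (hmaxH : ∀ i, i ≤ n → ω i 1 ≤ H) (hmaxX : ∀ i, i ≤ n → ω i 1 = H → ω i 0 ≤ xm)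
    (hX3 : ∀ t, t ≤ n → ω t ≠ pt (xm - 3) H)
    (hp1 : ω (i₀ - 1) = pt xm (H - 1)) (hp2 : ω (i₀ - 2) = pt (xm - 1) (H - 1))
    (hs5 : ω (i₀ + 5) = pt (xm - 4) (H - 1)) (hs6 : ω (i₀ + 6) = pt (xm - 4) H) :
    4 ≤ xm ∧ SpliceAddOK n 2 7 ω (i₀ - 1) (tpath offV 9 xm H false) ∧
      (∀ s, s ≤ 7 → ω (i₀ - 1 + s) = tpath wV 7 xm H false s) := by
  obtain ⟨hE, hlex⟩ := mem_canonEnd.1 hω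
  obtain ⟨⟨h0, -, hbw, hinj⟩, hn'⟩ := mem_endAt_iff.1 hE
  have hH1 : 1 ≤ H := by
    have h1 := apply_one_of_mem_canonEnd hω (by omega); have := hmaxH 1 (by omega); rw [h1.2] at this; exact this
  have hpar : (xm + H) % 2 = 1 := by
    have hvc := vertical_cases (hbw (i₀ - 1) (by omega)) (by rw [show i₀ - 1 + 1 = i₀ by omega, hv, hp1]; simp)
    rw [show i₀ - 1 + 1 = i₀ by omega, hv, hp1] at hvc; simp only [pt_apply_zero, pt_apply_one] at hvc; omega
  obtain ⟨hi₀1n, s1⟩ := corner_succ_of_pred_down hE hx2 hmaxH hmaxX (by omega) (by omega) hv hp1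
  obtain ⟨hi₀2n, s2⟩ := top_corner_succ hω (by omega) hi₀1n hv hmaxH s1 hp1
  obtain ⟨hi₀3n, s3⟩ := notX_succ_bwd hE hpar hH1 hmaxH hi₀2n s2 s1 hX3
  have s4 : ω (i₀ + 4) = pt (xm - 3) (H - 1) := by
    have hadj : brickWallGraph.Adj (ω (i₀ + 3)) (ω (i₀ + 4)) := hbw (i₀ + 3) (by omega)
    rw [s3] at hadj
    have hne2 : ω (i₀ + 4) ≠ ω (i₀ - 2) := fun h => by
      have := hinj (show i₀ + 4 ∈ {i | i ≤ n} by simp; omega) (show i₀ - 2 ∈ {i | i ≤ n} by simp; omega) h; omega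
    have hne3 : ω (i₀ + 4) ≠ ω (i₀ + 2) := fun h => by
      have := hinj (show i₀ + 4 ∈ {i | i ≤ n} by simp; omega) (show i₀ + 2 ∈ {i | i ≤ n} by simp; omega) h; omega
    rcases adj_cases hadj with ⟨hz0, hz1⟩ | ⟨hz0, hz1⟩ | hz0
    · exfalso; apply hne2; rw [hp2, lc_site_eq_iff]; simp only [pt_apply_zero, pt_apply_one] at hz0 hz1 ⊢; omega
    · rw [lc_site_eq_iff]; simp only [pt_apply_zero, pt_apply_one] at hz0 hz1 ⊢; omega
    · rcases vertical_cases hadj hz0 with ⟨hy, hp⟩ | ⟨hy, hp⟩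
      · exfalso; apply hne3; rw [s2, lc_site_eq_iff]; simp only [pt_apply_zero, pt_apply_one] at hz0 hy ⊢; omega
      · exfalso; simp only [pt_apply_zero, pt_apply_one] at hz0 hy hp; omega
  have hx4 : 4 ≤ xm := by have := col_nonneg_of_mem_canonEnd hω (i₀ + 6); rw [hs6] at this; simp at this; omega
  have hw : ∀ s, s ≤ 7 → ω (i₀ - 1 + s) = tpath wV 7 xm H false s := by
    intro s hs
    interval_cases s
    · exact tpath_eq (by rw [show i₀ - 1 + 0 = i₀ - 1 by omega, hp1]) (by simp [rd, wV])
    · exact tpath_eq (by rw [show i₀ - 1 + 1 = i₀ by omega, hv]) (by simp [rd, wV])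
    · exact tpath_eq (by rw [show i₀ - 1 + 2 = i₀ + 1 by omega, s1]) (by simp [rd, wV])
    · exact tpath_eq (by rw [show i₀ - 1 + 3 = i₀ + 2 by omega, s2]) (by simp [rd, wV])
    · exact tpath_eq (by rw [show i₀ - 1 + 4 = i₀ + 3 by omega, s3]) (by simp [rd, wV])
    · exact tpath_eq (by rw [show i₀ - 1 + 5 = i₀ + 4 by omega, s4]) (by simp [rd, wV])
    · exact tpath_eq (by rw [show i₀ - 1 + 6 = i₀ + 5 by omega, hs5]) (by simp [rd, wV])
    · exact tpath_eq (by rw [show i₀ - 1 + 7 = i₀ + 6 by omega, hs6]) (by simp [rd, wV])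
  exact ⟨hx4, spliceOK_V hE hpar hx4 hH1 hmaxH hmaxX hX3 hw (by omega), hw⟩

end CrownData


/-! ### The image: top corner, leaf shape, decoding -/

section CrownImage

variable {xm H : ℤ} {fwd : Bool} {j : ℕ}

/-- **Top corner of a crown image**: `(xm + 1, H + 1)`, at table index `6` (time `j + 6` forward, `j + 3` backward).
[cite: MadrasSlade1993, §3.2 (proof of Theorem 3.2.3: the lexicographically largest point)] -/
theorem topAt_spliceV (hmaxH : ∀ i, i ≤ n → ω i 1 ≤ H) (hmaxX : ∀ i, i ≤ n → ω i 1 = H → ω i 0 ≤ xm)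
    (hP : SpliceAddOK n 2 7 ω j (tpath offV 9 xm H fwd)) :
    TopSix (n + 2) (spliceAdd 2 7 ω (tpath offV 9 xm H fwd) j) (H + 1) (xm + 1) (j + rd fwd 9 6) :=
  topAt_spliceAdd hmaxH hmaxX hP (by norm_num) (by omega) (fun u hu => by
    interval_cases u <;> simp only [offV] <;> omega) (by norm_num) rfl

/-- **Signature of a crown image, forward**: corner `(xm+1,H+1)` at `j+6`, then DOWN to `(xm+1,H)` at `j+7`, LEFT to `(xm,H)` at `j+8`;
and `(xm,H+1)` at `j+5`. [cite: MadrasSlade1993, §3.2 (proof of Theorem 3.2.3)] -/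
theorem spliceV_signature_fwd (hP : SpliceAddOK n 2 7 ω j (tpath offV 9 xm H true)) :
    spliceAdd 2 7 ω (tpath offV 9 xm H true) j (j + 7) = pt (xm + 1) H ∧
    spliceAdd 2 7 ω (tpath offV 9 xm H true) j (j + 8) = pt xm H ∧
    spliceAdd 2 7 ω (tpath offV 9 xm H true) j (j + 5) = pt xm (H + 1) := by
  refine ⟨?_, ?_, ?_⟩ <;> (rw [spliceAdd_mid hP.start (by norm_num)]; simp [tpath, rd, offV])

/-- **Signature of a crown image, backward**: `(xm,H)` at `j+1`, `(xm+1,H)` at `j+2`, the corner at `j+3`, `(xm,H+1)` at `j+4`.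
[cite: MadrasSlade1993, §3.2 (proof of Theorem 3.2.3)] -/
theorem spliceV_signature_bwd (hP : SpliceAddOK n 2 7 ω j (tpath offV 9 xm H false)) :
    spliceAdd 2 7 ω (tpath offV 9 xm H false) j (j + 2) = pt (xm + 1) H ∧
    spliceAdd 2 7 ω (tpath offV 9 xm H false) j (j + 1) = pt xm H ∧
    spliceAdd 2 7 ω (tpath offV 9 xm H false) j (j + 4) = pt xm (H + 1) := by
  refine ⟨?_, ?_, ?_⟩
  · rw [spliceAdd_mid hP.start (by norm_num)]; simp [tpath, rd, offV]
  · rw [spliceAdd_mid hP.start (by norm_num)]; simp [tpath, rd, offV]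
  · rw [spliceAdd_mid hP.start (by norm_num)]; simp [tpath, rd, offV]

/-- **A crown image avoids `(xm−2, H+1)`** (three steps left of its corner): new sites at height `H+1` have abscissae `≥ xm−1`, old
sites have height `≤ H`. [cite: MadrasSlade1993, §3.2 (proof of Theorem 3.2.3)] -/
theorem spliceV_free_left3 (hmaxH : ∀ i, i ≤ n → ω i 1 ≤ H) (hP : SpliceAddOK n 2 7 ω j (tpath offV 9 xm H fwd)) :
    ∀ t, t ≤ n + 2 → spliceAdd 2 7 ω (tpath offV 9 xm H fwd) j t ≠ pt (xm - 2) (H + 1) := by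
  intro t ht he
  rcases spliceAdd_site_cases hP ht with ⟨a, ha, -, hta⟩ | ⟨s, hs, hts⟩
  · rw [hta] at he; have := hmaxH a ha; rw [he] at this; simp only [pt_apply_one] at this; omega
  · rw [hts, tpath] at he
    obtain ⟨e1, e2⟩ := pt_inj.1 he
    have hr := rd_le (fwd := fwd) hs
    generalize rd fwd 9 s = u at e1 e2 hr
    interval_cases u <;> simp only [offV] at e1 e2 <;> omega

/-- **A crown image is in the leaf class** (its top-right hexagon, the crown, hangs on the old top-right hexagon only).
[cite: MadrasSlade1993, §3.2 (proof of Theorem 3.2.3)] -/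
theorem isTopLeaf_spliceV (hx2 : 2 ≤ xm)
    (hmaxH : ∀ i, i ≤ n → ω i 1 ≤ H) (hmaxX : ∀ i, i ≤ n → ω i 1 = H → ω i 0 ≤ xm)
    (hP : SpliceAddOK n 2 7 ω j (tpath offV 9 xm H fwd)) : IsTopLeaf (n + 2) (spliceAdd 2 7 ω (tpath offV 9 xm H fwd) j) := by
  obtain ⟨T1, T2, T3, T4⟩ := topAt_spliceV hmaxH hmaxX hP
  have hwnd := hP.wnd
  have hfree := spliceV_free_left3 hmaxH hP
  refine ⟨H + 1, xm + 1, j + rd fwd 9 6, by unfold rd; split_ifs <;> omega, T4, by omega, T1, T2,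
    fun t ht => by rw [show xm + 1 - 3 = xm - 2 by ring]; exact hfree t ht, ?_⟩
  cases fwd
  · obtain ⟨h2, h1, -⟩ := spliceV_signature_bwd hP
    right
    refine ⟨by unfold rd; simp, ?_, ?_⟩
    · simp only [rd, Bool.false_eq_true, ↓reduceIte, show j + (9 - 6) - 1 = j + 2 by omega, h2]; ring_nf
    · simp only [rd, Bool.false_eq_true, ↓reduceIte, show j + (9 - 6) - 2 = j + 1 by omega, h1]; ring_nf
  · obtain ⟨h7, h8, -⟩ := spliceV_signature_fwd hP
    left
    refine ⟨by unfold rd; simp; omega, ?_, ?_⟩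
    · simp only [rd, ↓reduceIte, show j + 6 + 1 = j + 7 by omega, h7]; ring_nf
    · simp only [rd, ↓reduceIte, show j + 6 + 2 = j + 8 by omega, h8]; ring_nf

/-- **Decoding within the crown class**: the image's top corner pins `(xm, H)` and the corner time; the site one step after the corner
time pins the orientation (`(xm+1,H)` forward, `(xm,H+1)` backward); then `eq_of_spliceAdd_eq` reads `ω` off.
[cite: MadrasSlade1993, §3.2 (proof of Theorem 3.2.3: "Q can be unambiguously determined")] -/
theorem spliceV_decode {ω₁ ω₂ : ℕ → Site 2} {xm₁ H₁ xm₂ H₂ : ℤ} {j₁ j₂ : ℕ} {fwd₁ fwd₂ : Bool}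
    (hω₁ : ω₁ ∈ canonEnd n) (hω₂ : ω₂ ∈ canonEnd n)
    (hmaxH₁ : ∀ i, i ≤ n → ω₁ i 1 ≤ H₁) (hmaxX₁ : ∀ i, i ≤ n → ω₁ i 1 = H₁ → ω₁ i 0 ≤ xm₁)
    (hmaxH₂ : ∀ i, i ≤ n → ω₂ i 1 ≤ H₂) (hmaxX₂ : ∀ i, i ≤ n → ω₂ i 1 = H₂ → ω₂ i 0 ≤ xm₂)
    (hP₁ : SpliceAddOK n 2 7 ω₁ j₁ (tpath offV 9 xm₁ H₁ fwd₁)) (hP₂ : SpliceAddOK n 2 7 ω₂ j₂ (tpath offV 9 xm₂ H₂ fwd₂))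
    (hw₁ : ∀ s, s ≤ 7 → ω₁ (j₁ + s) = tpath wV 7 xm₁ H₁ fwd₁ s) (hw₂ : ∀ s, s ≤ 7 → ω₂ (j₂ + s) = tpath wV 7 xm₂ H₂ fwd₂ s)
    (h : spliceAdd 2 7 ω₁ (tpath offV 9 xm₁ H₁ fwd₁) j₁ = spliceAdd 2 7 ω₂ (tpath offV 9 xm₂ H₂ fwd₂) j₂) : ω₁ = ω₂ := by
  obtain ⟨hE₁, -⟩ := mem_canonEnd.1 hω₁
  obtain ⟨hE₂, -⟩ := mem_canonEnd.1 hω₂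
  have hW : spliceAdd 2 7 ω₁ (tpath offV 9 xm₁ H₁ fwd₁) j₁ ∈ endAt (n + 2) (Pi.single 0 1 : Site 2) := spliceAdd_mem hE₁ hP₁
  have hinj := (mem_endAt_iff.1 hW).1.2.2.2
  have T₁ := topAt_spliceV hmaxH₁ hmaxX₁ hP₁
  have T₂ := topAt_spliceV hmaxH₂ hmaxX₂ hP₂
  rw [← h] at T₂
  obtain ⟨eH, ex, eτ⟩ := topAt_unique hinj T₁ T₂
  have eH' : H₁ = H₂ := by omega
  have ex' : xm₁ = xm₂ := by omega
  subst eH' ex'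
  cases fwd₁ <;> cases fwd₂ <;> simp only [rd, Bool.false_eq_true, ↓reduceIte] at eτ
  · have ej : j₁ = j₂ := by omega
    subst ej
    exact eq_of_spliceAdd_eq hE₁ hE₂ hP₁ hP₂ hw₁ hw₂ h
  · -- ω₁ backward (corner at j₁+3), ω₂ forward (corner at j₂+6): the site at corner-time + 1
    exfalso
    obtain ⟨-, -, h4⟩ := spliceV_signature_bwd hP₁
    obtain ⟨h7, -, -⟩ := spliceV_signature_fwd hP₂
    rw [h, show j₁ + 4 = j₂ + 7 by omega, h7] at h4
    have := (pt_inj.1 h4).2; omega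
  · exfalso
    obtain ⟨-, -, h4⟩ := spliceV_signature_bwd hP₂
    obtain ⟨h7, -, -⟩ := spliceV_signature_fwd hP₁
    rw [← h, show j₂ + 4 = j₁ + 7 by omega, h7] at h4
    have := (pt_inj.1 h4).2; omega
  · have ej : j₁ = j₂ := by omega
    subst ej
    exact eq_of_spliceAdd_eq hE₁ hE₂ hP₁ hP₂ hw₁ hw₂ h

end CrownImage


/-! ### PART II — the bottom-leaf class and its stability under high surgeries -/

section BotLeaf

/-- **The bottom-leaf class** (mirror image of `IsTopLeaf`): at the bottom corner `(xb, L) = ω i₀` (largest abscissa on the LOWEST row of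
vertices) the site `(xb−3, L)` is off `ω` and above the corner the walk steps up and then LEFT (forward or backward in time) — the
bottom-right hexagon `[xb−2,xb]×[L,L+1]` of the polygon hangs on its upper-left neighbour only.
[cite: MadrasSlade1993, §3.2 (proof of Theorem 3.2.3: the local structure at an extreme point)] -/
def IsBotLeaf (n : ℕ) (ω : ℕ → Site 2) : Prop :=
  ∃ (L xb : ℤ) (i₀ : ℕ), i₀ + 1 ≤ n ∧ ω i₀ = pt xb L ∧ 2 ≤ xb ∧
    (∀ i, i ≤ n → L ≤ ω i 1) ∧ (∀ i, i ≤ n → ω i 1 = L → ω i 0 ≤ xb) ∧ (∀ t, t ≤ n → ω t ≠ pt (xb - 3) L) ∧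
    ((i₀ + 2 ≤ n ∧ ω (i₀ + 1) = pt xb (L + 1) ∧ ω (i₀ + 2) = pt (xb - 1) (L + 1)) ∨
      (2 ≤ i₀ ∧ ω (i₀ - 1) = pt xb (L + 1) ∧ ω (i₀ - 2) = pt (xb - 1) (L + 1)))

/-- A bottom-leaf datum gives the intrinsic bottom corner. [cite: MadrasSlade1993, §3.2 (proof of Theorem 3.2.3)] -/
theorem botSix_of_isBotLeaf {N : ℕ} {W : ℕ → Site 2} (h : IsBotLeaf N W) :
    ∃ (L xb : ℤ) (i₀ : ℕ), BotSix N W L xb i₀ ∧ (∀ t, t ≤ N → W t ≠ pt (xb - 3) L) ∧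
      ((i₀ + 2 ≤ N ∧ W (i₀ + 1) = pt xb (L + 1) ∧ W (i₀ + 2) = pt (xb - 1) (L + 1)) ∨
        (2 ≤ i₀ ∧ W (i₀ - 1) = pt xb (L + 1) ∧ W (i₀ - 2) = pt (xb - 1) (L + 1))) := by
  obtain ⟨L, xb, i₀, hi₀n, hv, -, hminH, hmaxX, hX, hpat⟩ := h
  exact ⟨L, xb, i₀, ⟨hminH, hmaxX, by omega, hv⟩, hX, hpat⟩

/-- **A bottom leaf survives a high `+2` surgery**: if the window sites and the new sites of an admissible `+2` splice all have height
`≥ B` with `L + 2 ≤ B`, a bottom-leaf polygon has a bottom-leaf image (the leaf block, at heights `L`, `L+1`, sits before or after the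
window and is copied). [cite: MadrasSlade1993, §3.2 (proof of Theorem 3.2.3)] -/
theorem isBotLeaf_spliceAdd_high {Lw j : ℕ} {π : ℕ → Site 2} {B : ℤ} (hP : SpliceAddOK n 2 Lw ω j π)
    (hπ : ∀ s, s ≤ Lw + 2 → B ≤ π s 1) (hwin : ∀ s, s ≤ Lw → B ≤ ω (j + s) 1)
    (hleaf : IsBotLeaf n ω) (hB : ∀ L : ℤ, (∀ i, i ≤ n → L ≤ ω i 1) → L + 2 ≤ B) :
    IsBotLeaf (n + 2) (spliceAdd 2 Lw ω π j) := by
  obtain ⟨L, xb, t₀, ht₀n, hv, hx2, hminH, hmaxX, hX, hpat⟩ := hleaf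
  have hLB : L + 2 ≤ B := hB L hminH
  have hwnd := hP.wnd
  have site : ∀ i, i ≤ n + 2 →
      (∃ a, a ≤ n ∧ (a ≤ j ∨ j + Lw ≤ a) ∧ spliceAdd 2 Lw ω π j i = ω a) ∨ B ≤ spliceAdd 2 Lw ω π j i 1 := by
    intro i hi
    rcases spliceAdd_site_cases hP hi with h | ⟨s, hs, e⟩
    · exact Or.inl h
    · right; rw [e]; exact hπ s hs
  have hminH' : ∀ i, i ≤ n + 2 → L ≤ spliceAdd 2 Lw ω π j i 1 := by
    intro i hi
    rcases site i hi with ⟨a, ha, -, e⟩ | h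
    · rw [e]; exact hminH a ha
    · omega
  have hmaxX' : ∀ i, i ≤ n + 2 → spliceAdd 2 Lw ω π j i 1 = L → spliceAdd 2 Lw ω π j i 0 ≤ xb := by
    intro i hi hiL
    rcases site i hi with ⟨a, ha, -, e⟩ | h
    · rw [e] at hiL ⊢; exact hmaxX a ha hiL
    · omega
  have hX' : ∀ t, t ≤ n + 2 → spliceAdd 2 Lw ω π j t ≠ pt (xb - 3) L := by
    intro t ht e
    rcases site t ht with ⟨a, ha, -, e'⟩ | h
    · exact hX a ha (e'.symm.trans e)
    · rw [e, pt_apply_one] at h; omega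
  have notwin : ∀ t, t ≤ n → ω t 1 ≤ L + 1 → t < j ∨ j + Lw < t := by
    intro t ht hth
    by_contra hcon
    push Not at hcon
    obtain ⟨s, rfl⟩ : ∃ s, t = j + s := ⟨t - j, by omega⟩
    have := hwin s (by omega); omega
  have hvL : ω t₀ 1 ≤ L + 1 := by rw [hv]; simp
  rcases hpat with ⟨ht2, h1, h2⟩ | ⟨ht2, h1, h2⟩
  · have g1 : ω (t₀ + 1) 1 ≤ L + 1 := by rw [h1]; simp
    have g2 : ω (t₀ + 2) 1 ≤ L + 1 := by rw [h2]; simp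
    rcases notwin t₀ (by omega) hvL with hlt | hgt
    · have hb1 := notwin (t₀ + 1) (by omega) g1
      have hb2 := notwin (t₀ + 2) (by omega) g2
      have ht2j : t₀ + 2 ≤ j := by omega
      refine ⟨L, xb, t₀, by omega, ?_, hx2, hminH', hmaxX', hX', Or.inl ⟨by omega, ?_, ?_⟩⟩
      · rw [spliceAdd_of_le (by omega), hv]
      · rw [spliceAdd_of_le (by omega), h1]
      · rw [spliceAdd_of_le ht2j, h2]
    · refine ⟨L, xb, t₀ + 2, by omega, ?_, hx2, hminH', hmaxX', hX', Or.inl ⟨by omega, ?_, ?_⟩⟩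
      · rw [spliceAdd_of_ge hP.finish (by omega), show t₀ + 2 - 2 = t₀ by omega, hv]
      · rw [spliceAdd_of_ge hP.finish (by omega), show t₀ + 2 + 1 - 2 = t₀ + 1 by omega, h1]
      · rw [spliceAdd_of_ge hP.finish (by omega), show t₀ + 2 + 2 - 2 = t₀ + 2 by omega, h2]
  · have g1 : ω (t₀ - 1) 1 ≤ L + 1 := by rw [h1]; simp
    have g2 : ω (t₀ - 2) 1 ≤ L + 1 := by rw [h2]; simp
    rcases notwin t₀ (by omega) hvL with hlt | hgt
    · refine ⟨L, xb, t₀, by omega, ?_, hx2, hminH', hmaxX', hX', Or.inr ⟨ht2, ?_, ?_⟩⟩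
      · rw [spliceAdd_of_le (by omega), hv]
      · rw [spliceAdd_of_le (by omega), h1]
      · rw [spliceAdd_of_le (by omega), h2]
    · have hb1 := notwin (t₀ - 1) (by omega) g1
      have hb2 := notwin (t₀ - 2) (by omega) g2
      refine ⟨L, xb, t₀ + 2, by omega, ?_, hx2, hminH', hmaxX', hX', Or.inr ⟨by omega, ?_, ?_⟩⟩
      · rw [spliceAdd_of_ge hP.finish (by omega), show t₀ + 2 - 2 = t₀ by omega, hv]
      · rw [spliceAdd_of_ge hP.finish (by omega), show t₀ + 2 - 1 - 2 = t₀ - 1 by omega, h1]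
      · rw [spliceAdd_of_ge hP.finish (by omega), show t₀ + 2 - 2 - 2 = t₀ - 2 by omega, h2]

/-- **A bottom image of the two-corner map is not in the bottom-leaf class**: for a case-X♭ image the site two steps above its corner
(in time) is the OLD corner, to the RIGHT; a floor image carries the bottom-row site `(x'−3, L')` three places left of its corner.
(Mirror image of `not_isTopLeaf_of_roofDatum`.) [cite: MadrasSlade1993, §3.2 (proof of Theorem 3.2.3)] -/
theorem not_isBotLeaf_of_bottomDatum {W : ℕ → Site 2} {L xb : ℤ} {j k : ℕ} {fwd : Bool} (hω : ω ∈ canonEnd n)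
    (hminH : ∀ i, i ≤ n → L ≤ ω i 1) (hmaxX : ∀ i, i ≤ n → ω i 1 = L → ω i 0 ≤ xb)
    (hd : BottomDatum n ω W L xb j k fwd) : ¬ IsBotLeaf (n + 2) W := by
  intro hleaf
  obtain ⟨hE, -⟩ := mem_canonEnd.1 hω
  obtain ⟨L', x', τ, T', hX', hpat⟩ := botSix_of_isBotLeaf hleaf
  rcases hd with ⟨-, hP, hw, hvf, hvb, rfl⟩ | ⟨hk, -, hP, hw, hpre, hpost, rfl⟩
  · -- case X♭ image: corner `(xb−1, L−1)` at `j + rd fwd 4 3`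
    have hW := spliceAdd_mem hE hP
    have hinj := (mem_endAt_iff.1 hW).1.2.2.2
    obtain ⟨eL, ex, eτ⟩ := botAt_unique hinj (botAt_spliceXb hminH hmaxX hP) T'
    cases fwd <;> simp only [rd, Bool.false_eq_true, ↓reduceIte] at eτ
    · -- backward: W(j−1) = (xb,L) [old corner], W(j) = (xb−1,L), corner at j+1, W(j+2) = (xb−2,L−1)
      obtain ⟨hj, hv⟩ := hvb rfl
      obtain ⟨e1, e0, -⟩ := spliceXb_signature_bwd hP hj hv
      have e2 : spliceAdd 2 2 ω (tpath offXb 4 xb L false) j (j + 2) = pt (xb - 2) (L - 1) := by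
        rw [spliceAdd_mid hP.start (by norm_num)]; simp [tpath, rd, offXb]; ring_nf
      rcases hpat with ⟨-, h1, -⟩ | ⟨-, -, h2⟩
      · rw [← eτ, show j + 1 + 1 = j + 2 by omega, e2] at h1; have := (pt_inj.1 h1).2; omega
      · rw [← eτ, show j + 1 - 2 = j - 1 by omega, e1] at h2; have := (pt_inj.1 h2).1; omega
    · -- forward: corner at j+3, W(j+4) = (xb−1,L), W(j+5) = (xb,L); W(j+2) = (xb−2,L−1)
      obtain ⟨-, h4, h5⟩ := spliceXb_signature_fwd hP (hvf rfl)
      have e2 : spliceAdd 2 2 ω (tpath offXb 4 xb L true) j (j + 2) = pt (xb - 2) (L - 1) := by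
        rw [spliceAdd_mid hP.start (by norm_num)]; simp [tpath, rd, offXb]; ring_nf
      rcases hpat with ⟨-, -, h2⟩ | ⟨-, h1, -⟩
      · rw [← eτ, show j + 3 + 2 = j + 5 by omega, h5] at h2; have := (pt_inj.1 h2).1; omega
      · rw [← eτ, show j + 3 - 1 = j + 2 by omega, e2] at h1; have := (pt_inj.1 h1).2; omega
  · -- floor image: corner `(xb+2k, L)`; the site `(xb+2k−3, L)` is on the image
    have hW := spliceAdd_mem hE hP
    have hfr := (mem_endAt_iff.1 hE).1.2.1
    have hinj := (mem_endAt_iff.1 hW).1.2.2.2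
    obtain ⟨eL, ex, eτ⟩ := botAt_unique hinj (botAt_spliceYsb hminH hmaxX hP) T'
    have hx' : x' - 3 = xb + 2 * k - 3 := by omega
    have hL' : L' = L := by omega
    simp only [hx', hL'] at hX'
    have hwnd := hP.wnd
    obtain ⟨t, ht, e⟩ : ∃ t, t ≤ n + 2 ∧ spliceAdd 2 (2 * k) ω (tpath (offYsb k) (2 * k + 2) xb L fwd) j t = pt (xb + 2 * k - 3) L := by
      cases fwd
      · rcases Nat.lt_or_ge k 2 with hk1 | hk2
        · obtain ⟨q1, -⟩ := hpost rfl
          -- the time `j + 2k + 1`: genuine, or the walk is frozen at `e₀ = ω n` there — either way the site is on the image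
          by_cases hb : j + 2 * k + 1 ≤ n
          · refine ⟨j + 2 * k + 3, by omega, ?_⟩
            rw [spliceAdd_of_ge hP.finish (by omega), show j + 2 * k + 3 - 2 = j + 2 * k + 1 by omega, q1]
            exact pt_inj.2 ⟨by omega, rfl⟩
          · refine ⟨n + 2, le_rfl, ?_⟩
            rw [spliceAdd_of_ge hP.finish (by omega), show n + 2 - 2 = n by omega, ← hfr (j + 2 * k + 1) (by omega), q1]
            exact pt_inj.2 ⟨by omega, rfl⟩
        · exact ⟨j + (2 + 3), by omega, by exact_mod_cast (spliceYsb_sites_bwd hP).1 3 (by omega)⟩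
      · rcases Nat.lt_or_ge k 2 with hk1 | hk2
        · obtain ⟨hj3, q1, -, -⟩ := hpre rfl
          refine ⟨j - 1, by omega, ?_⟩
          rw [spliceAdd_of_le (by omega), q1]
          exact pt_inj.2 ⟨by omega, rfl⟩
        · have e := (spliceYsb_sites_fwd hP).1 (2 * k - 3) (by omega)
          refine ⟨j + (2 * k - 3), by omega, ?_⟩
          rw [e]; exact pt_inj.2 ⟨by omega, rfl⟩
    exact hX' t ht e

end BotLeaf


/-! ### PART III — the class, the datum, and the crown-slot injection -/

section CrownSlot

/-- **The leaf-crown class**: a top corner `(xm, H) = ω i₀` of the LEAF class whose support run is long (`ω (i₀∓5) = (xm−4,H−1)`)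
and whose top row has a one-hexagon gap left of the top-right hexagon (`ω (i₀∓6) = (xm−4, H)`), on a polygon with at least three rows
of hexagons (a site of height `≤ H − 3`; automatic for a top-leaf ∧ bottom-leaf polygon, recorded for the bottom-leaf transfer).
[cite: MadrasSlade1993, §3.2 (proof of Theorem 3.2.3: surgery at the lexicographically largest point)] -/
def IsLeafCrown (n : ℕ) (ω : ℕ → Site 2) : Prop :=
  ∃ (H xm : ℤ) (i₀ : ℕ), i₀ + 1 ≤ n ∧ ω i₀ = pt xm H ∧ 2 ≤ xm ∧
    (∀ i, i ≤ n → ω i 1 ≤ H) ∧ (∀ i, i ≤ n → ω i 1 = H → ω i 0 ≤ xm) ∧ (∀ t, t ≤ n → ω t ≠ pt (xm - 3) H) ∧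
    (∃ i, i ≤ n ∧ ω i 1 + 3 ≤ H) ∧
    ((i₀ + 2 ≤ n ∧ ω (i₀ + 1) = pt xm (H - 1) ∧ ω (i₀ + 2) = pt (xm - 1) (H - 1) ∧ 6 ≤ i₀ ∧
        ω (i₀ - 5) = pt (xm - 4) (H - 1) ∧ ω (i₀ - 6) = pt (xm - 4) H) ∨
      (2 ≤ i₀ ∧ ω (i₀ - 1) = pt xm (H - 1) ∧ ω (i₀ - 2) = pt (xm - 1) (H - 1) ∧ i₀ + 6 ≤ n ∧
        ω (i₀ + 5) = pt (xm - 4) (H - 1) ∧ ω (i₀ + 6) = pt (xm - 4) H))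

/-- A polygon of the leaf-crown class is in the leaf class. [cite: MadrasSlade1993, §3.2 (proof of Theorem 3.2.3)] -/
theorem isTopLeaf_of_isLeafCrown (h : IsLeafCrown n ω) : IsTopLeaf n ω := by
  obtain ⟨H, xm, i₀, hi₀n, hv, hx2, hmaxH, hmaxX, hX3, -, hpat⟩ := h
  rcases hpat with ⟨h2n, h1, h2, -, -, -⟩ | ⟨h2, h1, h2', -, -, -⟩
  · exact ⟨H, xm, i₀, hi₀n, hv, hx2, hmaxH, hmaxX, hX3, Or.inl ⟨h2n, h1, h2⟩⟩
  · exact ⟨H, xm, i₀, hi₀n, hv, hx2, hmaxH, hmaxX, hX3, Or.inr ⟨h2, h1, h2'⟩⟩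

/-- The decoding datum of a crown image. [cite: MadrasSlade1993, §3.2 (proof of Theorem 3.2.3)] -/
def CrownDatum (n : ℕ) (ω W : ℕ → Site 2) (H xm : ℤ) (j : ℕ) (fwd : Bool) : Prop :=
  2 ≤ xm ∧ SpliceAddOK n 2 7 ω j (tpath offV 9 xm H fwd) ∧ (∀ s, s ≤ 7 → ω (j + s) = tpath wV 7 xm H fwd s) ∧
    W = spliceAdd 2 7 ω (tpath offV 9 xm H fwd) j

/-- **An image with its decoding datum** for every polygon of the leaf-crown class. [cite: MadrasSlade1993, §3.2 (proof of Theorem 3.2.3)] -/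
theorem exists_leafCrown_image (hω : ω ∈ canonEnd n) (hm : IsLeafCrown n ω) :
    ∃ W : ℕ → Site 2, W ∈ canonEnd (n + 2) ∧ ∃ (H xm : ℤ) (j : ℕ) (fwd : Bool),
      (∀ i, i ≤ n → ω i 1 ≤ H) ∧ (∀ i, i ≤ n → ω i 1 = H → ω i 0 ≤ xm) ∧ (∃ i, i ≤ n ∧ ω i 1 + 3 ≤ H) ∧
        CrownDatum n ω W H xm j fwd := by
  obtain ⟨H, xm, i₀, hi₀n, hv, hx2, hmaxH, hmaxX, hX3, hdepth, hpat⟩ := hm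
  rcases hpat with ⟨h2n, h1, h2, hi₀6, h5, h6⟩ | ⟨hi₀2, h1, h2, h6n, h5, h6⟩
  · obtain ⟨-, hP, hw⟩ := stepTwo_data_V_fwd hω h2n hv hx2 hmaxH hmaxX hX3 h1 h2 hi₀6 h5 h6
    exact ⟨_, spliceAdd_mem_canonEnd hω hP, H, xm, i₀ - 6, true, hmaxH, hmaxX, hdepth, hx2, hP, hw, rfl⟩
  · obtain ⟨-, hP, hw⟩ := stepTwo_data_V_bwd hω hi₀2 h6n hv hx2 hmaxH hmaxX hX3 h1 h2 h5 h6
    exact ⟨_, spliceAdd_mem_canonEnd hω hP, H, xm, i₀ - 1, false, hmaxH, hmaxX, hdepth, hx2, hP, hw, rfl⟩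

/-- **Decoding of crown images is datum-free.** [cite: MadrasSlade1993, §3.2 (proof of Theorem 3.2.3: "Q can be unambiguously determined")] -/
theorem eq_of_leafCrown_image_eq {ω₁ ω₂ W : ℕ → Site 2} (hω₁ : ω₁ ∈ canonEnd n) (hω₂ : ω₂ ∈ canonEnd n)
    {H₁ xm₁ : ℤ} {j₁ : ℕ} {fwd₁ : Bool} {H₂ xm₂ : ℤ} {j₂ : ℕ} {fwd₂ : Bool}
    (hmaxH₁ : ∀ i, i ≤ n → ω₁ i 1 ≤ H₁) (hmaxX₁ : ∀ i, i ≤ n → ω₁ i 1 = H₁ → ω₁ i 0 ≤ xm₁)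
    (hmaxH₂ : ∀ i, i ≤ n → ω₂ i 1 ≤ H₂) (hmaxX₂ : ∀ i, i ≤ n → ω₂ i 1 = H₂ → ω₂ i 0 ≤ xm₂)
    (h₁ : CrownDatum n ω₁ W H₁ xm₁ j₁ fwd₁) (h₂ : CrownDatum n ω₂ W H₂ xm₂ j₂ fwd₂) : ω₁ = ω₂ := by
  obtain ⟨-, hP₁, hw₁, rfl⟩ := h₁
  obtain ⟨-, hP₂, hw₂, h⟩ := h₂
  exact spliceV_decode hω₁ hω₂ hmaxH₁ hmaxX₁ hmaxH₂ hmaxX₂ hP₁ hP₂ hw₁ hw₂ h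

/-- **A crown image of a bottom-leaf polygon is a bottom leaf**: every window site and every new site of the crown has height
`≥ H − 1 ≥ L + 2` on a polygon with a site of height `≤ H − 3`. [cite: MadrasSlade1993, §3.2 (proof of Theorem 3.2.3)] -/
theorem isBotLeaf_of_crownDatum {W : ℕ → Site 2} {H xm : ℤ} {j : ℕ} {fwd : Bool}
    (hd : CrownDatum n ω W H xm j fwd) (hdepth : ∃ i, i ≤ n ∧ ω i 1 + 3 ≤ H) (hb : IsBotLeaf n ω) :
    IsBotLeaf (n + 2) W := by
  obtain ⟨-, hP, hw, rfl⟩ := hd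
  obtain ⟨t, ht, hth⟩ := hdepth
  refine isBotLeaf_spliceAdd_high (B := H - 1) hP (fun s hs => ?_) (fun s hs => ?_) hb (fun L hL => ?_)
  · obtain ⟨u, hu, e⟩ := tpath_mem (off := offV) (K := 9) (xm := xm) (H := H) (fwd := fwd) (s := s) hs
    rw [e, pt_apply_one]; interval_cases u <;> simp [offV] <;> omega
  · rw [hw s hs]
    obtain ⟨u, hu, e⟩ := tpath_mem (off := wV) (K := 7) (xm := xm) (H := H) (fwd := fwd) (s := s) hs
    rw [e, pt_apply_one]; interval_cases u <;> simp [wV]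
  · have := hL t ht; omega

/-- **The class served by the crown slot on top of the two corners**: the two-corner class, or leaf-crown ∧ bottom-leaf.
[cite: MadrasSlade1993, §3.2 (proof of Theorem 3.2.3)] -/
def IsStepTwoCrownSlot (n : ℕ) (ω : ℕ → Site 2) : Prop := IsStepTwoTwoCorner n ω ∨ (IsLeafCrown n ω ∧ IsBotLeaf n ω)

/-- **★ The step two holds on the crown-slot class**: the canonical rooted `(n+1)`-gons (`n ≥ 5`) of class
X ∪ Y⋆ ∪ (leaf ∩ bottom-served) ∪ (leaf-crown ∩ bottom-leaf) inject into the canonical rooted `(n+3)`-gons.  Images of the three kinds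
are pairwise distinct: top images are not top-leaf; bottom images are top-leaf but not bottom-leaf; crown images are top-leaf AND
bottom-leaf. [cite: MadrasSlade1993, §3.2, Theorem 3.2.3 / (3.2.3) (the `ℤ^d` statement being transplanted)] -/
theorem card_filter_isStepTwoCrownSlot_le [DecidablePred (IsStepTwoCrownSlot n)] (hn : 5 ≤ n) :
    #((canonEnd n).filter (IsStepTwoCrownSlot n)) ≤ #(canonEnd (n + 2)) := by
  classical
  let P1 : (ℕ → Site 2) → Prop := fun ω => ω ∈ canonEnd n ∧ IsStepTwoRoof n ω
  let P2 : (ℕ → Site 2) → Prop := fun ω => ω ∈ canonEnd n ∧ IsTopLeaf n ω ∧ IsStepTwoBottom n ω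
  let P3 : (ℕ → Site 2) → Prop := fun ω => ω ∈ canonEnd n ∧ IsLeafCrown n ω ∧ IsBotLeaf n ω
  let E : (ℕ → Site 2) → (ℕ → Site 2) := fun ω =>
    if h : P1 ω then Classical.choose (exists_stepTwoRoof_image h.1 hn h.2)
    else if h' : P2 ω then Classical.choose (exists_stepTwoBottom_image h'.1 hn h'.2.2)
    else if h'' : P3 ω then Classical.choose (exists_leafCrown_image h''.1 h''.2.1)
    else ω
  have hE1 : ∀ ω (h : P1 ω), E ω = Classical.choose (exists_stepTwoRoof_image h.1 hn h.2) := fun ω h => dif_pos h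
  have hE2 : ∀ ω, ¬ P1 ω → ∀ h' : P2 ω, E ω = Classical.choose (exists_stepTwoBottom_image h'.1 hn h'.2.2) := by
    intro ω h1 h'
    show (if h : P1 ω then _ else _) = _
    rw [dif_neg h1, dif_pos h']
  have hE3 : ∀ ω, ¬ P1 ω → ¬ P2 ω → ∀ h'' : P3 ω, E ω = Classical.choose (exists_leafCrown_image h''.1 h''.2.1) := by
    intro ω h1 h2 h''
    show (if h : P1 ω then _ else _) = _
    rw [dif_neg h1, dif_neg h2, dif_pos h'']
  have himgR : ∀ ω (h : P1 ω), E ω ∈ canonEnd (n + 2) ∧ ¬ IsTopLeaf (n + 2) (E ω) ∧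
      ∃ (H xm : ℤ) (j k : ℕ) (fwd : Bool), (∀ i, i ≤ n → ω i 1 ≤ H) ∧ (∀ i, i ≤ n → ω i 1 = H → ω i 0 ≤ xm) ∧
        RoofDatum n ω (E ω) H xm j k fwd := by
    intro ω h
    rw [hE1 ω h]
    obtain ⟨hW, H, xm, j, k, fwd, hmaxH, hmaxX, hd⟩ := Classical.choose_spec (exists_stepTwoRoof_image h.1 hn h.2)
    exact ⟨hW, not_isTopLeaf_of_roofDatum h.1 (by omega) hmaxH hmaxX hd, H, xm, j, k, fwd, hmaxH, hmaxX, hd⟩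
  have himgB : ∀ ω, ¬ P1 ω → ∀ h' : P2 ω, E ω ∈ canonEnd (n + 2) ∧ IsTopLeaf (n + 2) (E ω) ∧ ¬ IsBotLeaf (n + 2) (E ω) ∧
      ∃ (L xb : ℤ) (j k : ℕ) (fwd : Bool), (∀ i, i ≤ n → L ≤ ω i 1) ∧ (∀ i, i ≤ n → ω i 1 = L → ω i 0 ≤ xb) ∧
        BottomDatum n ω (E ω) L xb j k fwd := by
    intro ω h1 h'
    rw [hE2 ω h1 h']
    obtain ⟨hW, L, xb, j, k, fwd, hminH, hmaxX, hd⟩ :=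
      Classical.choose_spec (exists_stepTwoBottom_image h'.1 hn h'.2.2)
    exact ⟨hW, isTopLeaf_of_bottomDatum h'.1 hd h'.2.1, not_isBotLeaf_of_bottomDatum h'.1 hminH hmaxX hd,
      L, xb, j, k, fwd, hminH, hmaxX, hd⟩
  have himgC : ∀ ω, ¬ P1 ω → ¬ P2 ω → ∀ h'' : P3 ω, E ω ∈ canonEnd (n + 2) ∧ IsTopLeaf (n + 2) (E ω) ∧ IsBotLeaf (n + 2) (E ω) ∧
      ∃ (H xm : ℤ) (j : ℕ) (fwd : Bool), (∀ i, i ≤ n → ω i 1 ≤ H) ∧ (∀ i, i ≤ n → ω i 1 = H → ω i 0 ≤ xm) ∧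
        CrownDatum n ω (E ω) H xm j fwd := by
    intro ω h1 h2 h''
    rw [hE3 ω h1 h2 h'']
    obtain ⟨hW, H, xm, j, fwd, hmaxH, hmaxX, hdepth, hd⟩ := Classical.choose_spec (exists_leafCrown_image h''.1 h''.2.1)
    refine ⟨hW, ?_, isBotLeaf_of_crownDatum hd hdepth h''.2.2, H, xm, j, fwd, hmaxH, hmaxX, hd⟩
    obtain ⟨hx2, hP, -, hWeq⟩ := hd
    rw [hWeq]; exact isTopLeaf_spliceV hx2 hmaxH hmaxX hP
  have hbranch : ∀ ω, ω ∈ canonEnd n → IsStepTwoCrownSlot n ω → P1 ω ∨ (¬ P1 ω ∧ P2 ω) ∨ (¬ P1 ω ∧ ¬ P2 ω ∧ P3 ω) := by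
    intro ω hω hc
    by_cases h1 : P1 ω
    · exact Or.inl h1
    by_cases h2 : P2 ω
    · exact Or.inr (Or.inl ⟨h1, h2⟩)
    refine Or.inr (Or.inr ⟨h1, h2, hω, ?_⟩)
    rcases hc with (hR | ⟨hl, hb⟩) | hs
    · exact absurd ⟨hω, hR⟩ h1
    · exact absurd ⟨hω, hl, hb⟩ h2
    · exact hs
  refine Finset.card_le_card_of_injOn E (fun ω hω => ?_) (fun ω₁ hω₁ ω₂ hω₂ heq => ?_)
  · rw [Finset.mem_coe, Finset.mem_filter] at hω
    rw [Finset.mem_coe]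
    rcases hbranch ω hω.1 hω.2 with h1 | ⟨h1, h2⟩ | ⟨h1, h2, h3⟩
    · exact (himgR ω h1).1
    · exact (himgB ω h1 h2).1
    · exact (himgC ω h1 h2 h3).1
  · rw [Finset.mem_coe, Finset.mem_filter] at hω₁ hω₂
    rcases hbranch ω₁ hω₁.1 hω₁.2 with a1 | ⟨a1, a2⟩ | ⟨a1, a2, a3⟩ <;>
      rcases hbranch ω₂ hω₂.1 hω₂.2 with b1 | ⟨b1, b2⟩ | ⟨b1, b2, b3⟩
    · obtain ⟨-, -, H₁, xm₁, j₁, k₁, fwd₁, hmaxH₁, hmaxX₁, h₁⟩ := himgR ω₁ a1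
      obtain ⟨-, -, H₂, xm₂, j₂, k₂, fwd₂, hmaxH₂, hmaxX₂, h₂⟩ := himgR ω₂ b1
      rw [heq] at h₁
      exact eq_of_stepTwoRoof_image_eq hω₁.1 hω₂.1 hmaxH₁ hmaxX₁ hmaxH₂ hmaxX₂ h₁ h₂
    · exfalso
      obtain ⟨-, hnl, -⟩ := himgR ω₁ a1
      obtain ⟨-, hl, -⟩ := himgB ω₂ b1 b2
      rw [heq] at hnl; exact hnl hl
    · exfalso
      obtain ⟨-, hnl, -⟩ := himgR ω₁ a1
      obtain ⟨-, hl, -⟩ := himgC ω₂ b1 b2 b3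
      rw [heq] at hnl; exact hnl hl
    · exfalso
      obtain ⟨-, hnl, -⟩ := himgR ω₂ b1
      obtain ⟨-, hl, -⟩ := himgB ω₁ a1 a2
      rw [← heq] at hnl; exact hnl hl
    · obtain ⟨-, -, -, L₁, xb₁, j₁, k₁, fwd₁, hminH₁, hmaxX₁, h₁⟩ := himgB ω₁ a1 a2
      obtain ⟨-, -, -, L₂, xb₂, j₂, k₂, fwd₂, hminH₂, hmaxX₂, h₂⟩ := himgB ω₂ b1 b2
      rw [heq] at h₁
      exact eq_of_stepTwoBottom_image_eq hω₁.1 hω₂.1 hminH₁ hmaxX₁ hminH₂ hmaxX₂ h₁ h₂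
    · exfalso
      obtain ⟨-, -, hnb, -⟩ := himgB ω₁ a1 a2
      obtain ⟨-, -, hbl, -⟩ := himgC ω₂ b1 b2 b3
      rw [heq] at hnb; exact hnb hbl
    · exfalso
      obtain ⟨-, hnl, -⟩ := himgR ω₂ b1
      obtain ⟨-, hl, -⟩ := himgC ω₁ a1 a2 a3
      rw [← heq] at hnl; exact hnl hl
    · exfalso
      obtain ⟨-, -, hbl, -⟩ := himgC ω₁ a1 a2 a3
      obtain ⟨-, -, hnb, -⟩ := himgB ω₂ b1 b2
      rw [heq] at hbl; exact hnb hbl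
    · obtain ⟨-, -, -, H₁, xm₁, j₁, fwd₁, hmaxH₁, hmaxX₁, h₁⟩ := himgC ω₁ a1 a2 a3
      obtain ⟨-, -, -, H₂, xm₂, j₂, fwd₂, hmaxH₂, hmaxX₂, h₂⟩ := himgC ω₂ b1 b2 b3
      rw [heq] at h₁
      exact eq_of_leafCrown_image_eq hω₁.1 hω₂.1 hmaxH₁ hmaxX₁ hmaxH₂ hmaxX₂ h₁ h₂

/-- **Complement form**: `#canonEnd n − #{leaf polygons served neither at the bottom nor by the crown} ≤ #canonEnd (n+2)`.
[cite: MadrasSlade1993, §3.2, Theorem 3.2.3 / (3.2.3)] -/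
theorem card_canonEnd_sub_card_filter_crownSlotResidue_le [DecidablePred (IsStepTwoCrownSlot n)]
    [DecidablePred fun ω => IsTopLeaf n ω ∧ ¬ IsStepTwoBottom n ω ∧ ¬ (IsLeafCrown n ω ∧ IsBotLeaf n ω)] (hn : 5 ≤ n) :
    #(canonEnd n) - #((canonEnd n).filter fun ω => IsTopLeaf n ω ∧ ¬ IsStepTwoBottom n ω ∧ ¬ (IsLeafCrown n ω ∧ IsBotLeaf n ω)) ≤
      #(canonEnd (n + 2)) := by
  classical
  have hcover : canonEnd n ⊆ (canonEnd n).filter (IsStepTwoCrownSlot n) ∪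
      (canonEnd n).filter (fun ω => IsTopLeaf n ω ∧ ¬ IsStepTwoBottom n ω ∧ ¬ (IsLeafCrown n ω ∧ IsBotLeaf n ω)) := by
    intro ω hω
    rcases isStepTwoRoof_or_isTopLeaf hω hn with h | h
    · exact Finset.mem_union_left _ (Finset.mem_filter.2 ⟨hω, Or.inl (Or.inl h)⟩)
    · by_cases hb : IsStepTwoBottom n ω
      · exact Finset.mem_union_left _ (Finset.mem_filter.2 ⟨hω, Or.inl (Or.inr ⟨h, hb⟩)⟩)
      · by_cases hs : IsLeafCrown n ω ∧ IsBotLeaf n ω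
        · exact Finset.mem_union_left _ (Finset.mem_filter.2 ⟨hω, Or.inr hs⟩)
        · exact Finset.mem_union_right _ (Finset.mem_filter.2 ⟨hω, h, hb, hs⟩)
  have h1 := (Finset.card_le_card hcover).trans (Finset.card_union_le _ _)
  have h2 := card_filter_isStepTwoCrownSlot_le (n := n) hn
  omega

/-- **Printed normalisation**: `q_{n+1}(ℍ) − #{crown-slot residue} ≤ q_{n+3}(ℍ)` (`n ≥ 5`). [cite: MadrasSlade1993, §3.2, Theorem 3.2.3 / (3.2.3)] -/
theorem hexPolygonNumber_sub_card_crownSlotResidue_le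
    [DecidablePred fun ω => IsTopLeaf n ω ∧ ¬ IsStepTwoBottom n ω ∧ ¬ (IsLeafCrown n ω ∧ IsBotLeaf n ω)] (hn : 5 ≤ n) :
    hexPolygonNumber (n + 1) -
        #((canonEnd n).filter fun ω => IsTopLeaf n ω ∧ ¬ IsStepTwoBottom n ω ∧ ¬ (IsLeafCrown n ω ∧ IsBotLeaf n ω)) ≤
      hexPolygonNumber (n + 3) := by
  classical
  have h := card_canonEnd_sub_card_filter_crownSlotResidue_le (n := n) hn
  rw [card_canonEnd (by omega), card_canonEnd (by omega)] at h
  exact h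

end CrownSlot

end PolygonConcat

end HexBW

end Literature.Probability.RandomPlanarGeometry.SAW

end
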